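import Summits.ResolutionOfSingularities.ResolutionOfSingularities.Theorems.FrobeniusLadderFInjectiveMacaulayficationPencilExitSoundnessKit
import Summits.ResolutionOfSingularities.ResolutionOfSingularities.Theorems.FrobeniusLadderFInjectiveMacaulayficationPencilIntegral
import Mathlib.Algebra.MvPolynomial.Equiv
import HarnessLib

/-!
# TASK 4b SOUNDNESS, first tag: the `W`-chart of the pencil blow-up is FULL at every closed point of an orbit where `M₁|_Z ≤ 1` (✓p694236 codes 2 «pencil j = p−1» and 4 «deep j = p−1»),
# EVERY prime `p` — the witness is the `W^{p−1}`-term of `Φ^{p−1}`, which no other term of the expansion can cancel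
# (crux `FInjectiveMacaulayfication` stmt-ResolutionOfSingularities-15315, chain w45a; RULING R23.2 (2); consumer res-L1-w45a-stub-3 TASK 4c; seat res-L1-w45a-stub-1 g14)

[OURS · L1 W4.5a] Support file (`--supports stmt-ResolutionOfSingularities-15315 --as helper`); theorems only; unconditional; any field of characteristic `p`. Nothing of the crux is proved; no
census row is asserted. AI-written (AI review is weaker than expert review).

LETTER (agreed shape, bus 04:18Z; pencil variable `W = X 0`, base letters `y_i = X i.succ`, as in ✓p692944 `PencilIntegral.pencilChart_isPrime`). Exponent data `M₁ M₂ r s : Fin n →₀ ℕ`;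
`Φ_W := (y^{M₁})⁺·W − (y^{M₂}·(y^r − y^s))⁺` (`q⁺ = rename Fin.succ q`); a closed point `P′ = (w₀; c)` of `V(Φ_W)` with `𝔪_{P′} ∩ k[W, y] = (W − w₀, y_i − c_i)`; its orbit is
`Z = {i : c_i = 0}`. CLAIM (`fullCl_pencilChartW_of_M₁_le_one`): if `Φ_W` is prime and `M₁ i ≤ 1` whenever `c_i = 0`, then `𝒪_{V(Φ_W), P′}` is `FullCl p`.
PROOF = ✓ `PencilExitSoundnessKit.hypersurface_fullCl_stalk_of_reduction` with the substitution `θ : W ↦ W + w₀, y_i ↦ c_i (c_i ≠ 0), y_i ↦ y_i (c_i = 0)`: `θ(Φ_W) = A′⁺·W + γ′⁺` with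
`A′ = α·y^{M₁|_Z}`, `α = ∏_{c_i ≠ 0} c_i^{M₁ i} ≠ 0`; in `k[y][W]` the `W^{p−1}`-coefficient of `θ(Φ_W)^{p−1}` is `A′^{p−1}` (leading coefficient of a power of a linear polynomial over the
domain `k[y]`), so the monomial `W^{p−1}·y^{(p−1)M₁|_Z}` is in the support, with all `Z ∪ {W}`-exponents `≤ p − 1`.
* §1 `theta0_monomial` (the substitution on a monomial); §2 ★★ `fullCl_pencilChartW_of_M₁_le_one`; §3 ★★ `fullCl_pencilChartU_pole_of_M₁_le_one` (the pole `U = 0` of the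
  fibre line, `Φ_U = B⁺·U − (y^{M₁})⁺`, witness the `U⁰`-term).
[cite: Fedder1983, Thm. 1.12]
-/

set_option linter.dupNamespace false

noncomputable section

open AlgebraicGeometry IsLocalRing MvPolynomial
open scoped Pointwise

namespace Summit.ResolutionOfSingularities.ResolutionOfSingularities.Theorems.FInjectiveMacaulayfication.PencilExitTagW

open Summit.ResolutionOfSingularities.ResolutionOfSingularities.Theorems.FInjectiveMacaulayfication
open SliceableCentre

variable (k : Type) [Field k] {n : ℕ}

/-! ## §1 The substitution on the base letters -/

/-- **The substitution `y_i ↦ c_i (c_i ≠ 0), y_i ↦ y_i (c_i = 0)` on a monomial**: `θ₀(y^M) = C(∏_{c_i ≠ 0} c_i^{M i}) · y^{M|_Z}`, `Z = {c = 0}`. [plumbing] -/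
theorem theta0_monomial [DecidableEq k] (c : Fin n → k) (M : Fin n →₀ ℕ) :
    aeval (fun i : Fin n => if c i = 0 then (X i : MvPolynomial (Fin n) k) else C (c i)) (monomial M (1 : k)) =
      C (∏ i ∈ M.support with c i ≠ 0, c i ^ M i) * monomial (M.filter fun i => c i = 0) 1 := by
  rw [aeval_monomial, map_one, one_mul, monomial_eq, C_1, one_mul]
  simp only [Finsupp.prod, Finsupp.support_filter, map_prod, map_pow]
  rw [← Finset.prod_filter_mul_prod_filter_not M.support (fun i => c i ≠ 0)]
  congr 1
  · exact Finset.prod_congr rfl fun i hi => by rw [Finset.mem_filter] at hi; rw [if_neg hi.2]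
  · have hs : M.support.filter (fun i => ¬ c i ≠ 0) = M.support.filter (fun i => c i = 0) := Finset.filter_congr fun i _ => not_not
    rw [hs]
    exact Finset.prod_congr rfl fun i hi => by
      rw [Finset.mem_filter] at hi; rw [if_pos hi.2, Finsupp.filter_apply_pos (fun i => c i = 0) M hi.2]

/-- The scalar `∏_{c_i ≠ 0} c_i^{M i}` is non-zero. [plumbing] -/
theorem theta0_scalar_ne_zero [DecidableEq k] (c : Fin n → k) (M : Fin n →₀ ℕ) : (∏ i ∈ M.support with c i ≠ 0, c i ^ M i) ≠ 0 := by
  refine Finset.prod_ne_zero_iff.2 fun i hi => ?_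
  rw [Finset.mem_filter] at hi
  exact pow_ne_zero _ hi.2

/-! ## §2 ★★ The `W^{p−1}` witness -/

set_option maxHeartbeats 800000 in
-- one long polynomial bookkeeping proof
/-- ★★ **THE `W`-CHART `V(Φ_W)`, `Φ_W = (y^{M₁})⁺·W − (y^{M₂}(y^r − y^s))⁺`, IS FULL AT EVERY CLOSED POINT `(w₀; c)` WITH `M₁ i ≤ 1` WHENEVER `c_i = 0`** (✓p694236 exit codes 2 and 4; every
prime `p`; `Φ_W` prime is a hypothesis, p- and tag-free). [OURS · TASK 4b soundness, first tag; cite: Fedder1983, Thm. 1.12] -/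
theorem fullCl_pencilChartW_of_M₁_le_one (p : ℕ) [Fact p.Prime] [CharP k p] (M₁ : Fin n →₀ ℕ) (B : MvPolynomial (Fin n) k)
    (Φ : MvPolynomial (Fin (n + 1)) k) (hΦ : Φ = rename Fin.succ (monomial M₁ (1 : k)) * X 0 - rename Fin.succ B) (hΦp : Prime Φ)
    (c : Fin n → k) (w₀ : k) (y : Spec (.of (MvPolynomial (Fin (n + 1)) k ⧸ Ideal.span {Φ}))) (hy : y.asIdeal.IsMaximal)
    (ha : y.asIdeal.comap (Ideal.Quotient.mk (Ideal.span {Φ})) =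
      Ideal.span (Set.range (Fin.cons ((X 0 : MvPolynomial (Fin (n + 1)) k) - C w₀) fun i : Fin n => X i.succ - C (c i))))
    (htag : ∀ i, c i = 0 → M₁ i ≤ 1) :
    FullCl p ((Spec (.of (MvPolynomial (Fin (n + 1)) k ⧸ Ideal.span {Φ}))).presheaf.stalk y) := by
  classical
  have hp1 : 1 ≤ p := (Fact.out : p.Prime).one_lt.le
  -- the substitution
  set v₀ : Fin n → MvPolynomial (Fin n) k := fun i => if c i = 0 then X i else C (c i) with hv₀
  set θ₀ : MvPolynomial (Fin n) k →ₐ[k] MvPolynomial (Fin n) k := aeval v₀ with hθ₀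
  set θ : MvPolynomial (Fin (n + 1)) k →ₐ[k] MvPolynomial (Fin (n + 1)) k :=
    aeval (Fin.cons (X 0 + C w₀) fun i : Fin n => rename Fin.succ (v₀ i)) with hθ
  have hθX0 : θ (X 0) = X 0 + C w₀ := by rw [hθ, aeval_X, Fin.cons_zero]
  have hθsucc : ∀ q : MvPolynomial (Fin n) k, θ (rename Fin.succ q) = rename Fin.succ (θ₀ q) := by
    intro q
    rw [hθ, aeval_rename, hθ₀, ← AlgHom.comp_apply]
    congr 1
    refine MvPolynomial.algHom_ext fun i => ?_
    rw [AlgHom.comp_apply, aeval_X, aeval_X, Function.comp_apply, Fin.cons_succ]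
  -- `θ(Φ) = A′⁺ W + γ′⁺`
  set α : k := ∏ i ∈ M₁.support with c i ≠ 0, c i ^ M₁ i with hα
  have hα0 : α ≠ 0 := theta0_scalar_ne_zero k c M₁
  set A' : MvPolynomial (Fin n) k := C α * monomial (M₁.filter fun i => c i = 0) 1 with hA'
  have hA'eq : θ₀ (monomial M₁ 1) = A' := by rw [hθ₀, hv₀, theta0_monomial]
  have hA'0 : A' ≠ 0 := by
    rw [hA', Ne, mul_eq_zero, not_or, C_eq_zero, monomial_eq_zero]; exact ⟨hα0, one_ne_zero⟩
  set γ' : MvPolynomial (Fin n) k := C w₀ * A' - θ₀ B with hγ'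
  have hθΦ : θ Φ = rename Fin.succ A' * X 0 + rename Fin.succ γ' := by
    have h1 : θ (rename Fin.succ (monomial M₁ (1 : k))) = rename Fin.succ A' := by rw [hθsucc, hA'eq]
    have h2 : θ (rename Fin.succ B) = rename Fin.succ (θ₀ B) := hθsucc B
    have h3 : rename Fin.succ γ' = C w₀ * rename Fin.succ A' - rename Fin.succ (θ₀ B) := by rw [hγ', map_sub, map_mul, rename_C]
    rw [hΦ, map_sub, map_mul, h1, h2, hθX0, h3]; ring
  -- in `k[y][W]`: the `W^{p−1}` coefficient of `θ(Φ)^{p−1}` is `A′^{p−1}`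
  have hfs : finSuccEquiv k n (θ Φ) = Polynomial.C A' * Polynomial.X + Polynomial.C γ' := by
    rw [hθΦ, map_add, map_mul, PencilIntegral.finSuccEquiv_rename_succ, PencilIntegral.finSuccEquiv_rename_succ, finSuccEquiv_X_zero]
  have hlead : ((finSuccEquiv k n (θ Φ)) ^ (p - 1)).coeff (p - 1) = A' ^ (p - 1) := by
    rw [hfs]
    have hdeg : (Polynomial.C A' * Polynomial.X + Polynomial.C γ').natDegree = 1 := Polynomial.natDegree_linear hA'0
    have hlc : (Polynomial.C A' * Polynomial.X + Polynomial.C γ').leadingCoeff = A' := Polynomial.leadingCoeff_linear hA'0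
    have h1 : ((Polynomial.C A' * Polynomial.X + Polynomial.C γ') ^ (p - 1)).natDegree = p - 1 := by rw [Polynomial.natDegree_pow, hdeg, mul_one]
    have h2 := Polynomial.coeff_natDegree (p := (Polynomial.C A' * Polynomial.X + Polynomial.C γ') ^ (p - 1))
    rw [h1] at h2
    rw [h2, Polynomial.leadingCoeff_pow, hlc]
  -- the witness monomial
  set d₀ : Fin n →₀ ℕ := (p - 1) • M₁.filter fun i => c i = 0 with hd₀
  have hcoeff : coeff (Finsupp.cons (p - 1) d₀) (θ Φ ^ (p - 1)) = α ^ (p - 1) := by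
    rw [← finSuccEquiv_coeff_coeff, map_pow, hlead, hA', mul_pow, ← map_pow, monomial_pow, one_pow, coeff_C_mul, ← hd₀, coeff_monomial, if_pos rfl, mul_one]
  have hd : Finsupp.cons (p - 1) d₀ ∈ ((θ : MvPolynomial (Fin (n + 1)) k →+* MvPolynomial (Fin (n + 1)) k) Φ ^ (p - 1)).support := by
    rw [mem_support_iff, RingHom.coe_coe, hcoeff]; exact pow_ne_zero _ hα0
  -- the test variables and the generators
  refine PencilExitSoundnessKit.hypersurface_fullCl_stalk_of_reduction k p Φ hΦp _ y hy ha (θ : MvPolynomial (Fin (n + 1)) k →+* MvPolynomial (Fin (n + 1)) k)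
    ({0} ∪ Set.range fun i : {i : Fin n // c i = 0} => (i.1.succ : Fin (n + 1))) (fun j => ?_) _ hd (fun j hj => ?_)
  · -- `θ` on the generators
    refine Fin.cases ?_ (fun i => ?_) j
    · right
      refine ⟨0, Set.mem_union_left _ rfl, ?_⟩
      rw [Fin.cons_zero, RingHom.coe_coe, map_sub, hθX0, hθ, aeval_C, algebraMap_eq]; ring
    · have hθi : θ (X i.succ) = rename Fin.succ (v₀ i) := by rw [hθ, aeval_X, Fin.cons_succ]
      by_cases hci : c i = 0
      · right
        refine ⟨i.succ, Set.mem_union_right _ ⟨⟨i, hci⟩, rfl⟩, ?_⟩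
        rw [Fin.cons_succ, RingHom.coe_coe, map_sub, hθi, hv₀]; dsimp only; rw [if_pos hci, rename_X, hθ, aeval_C, algebraMap_eq, hci, C_0, sub_zero]
      · left
        rw [Fin.cons_succ, RingHom.coe_coe, map_sub, hθi, hv₀]; dsimp only; rw [if_neg hci, rename_C, hθ, aeval_C, algebraMap_eq, sub_self]
  · -- smallness of the witness exponents on `Z ∪ {W}`
    rcases hj with hj | ⟨⟨i, hci⟩, rfl⟩
    · rw [Set.mem_singleton_iff] at hj; subst hj
      rw [Finsupp.cons_zero]; omega
    · rw [Finsupp.cons_succ, hd₀, Finsupp.smul_apply, Finsupp.filter_apply_pos (fun i => c i = 0) M₁ hci, smul_eq_mul]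
      have := htag i hci
      calc (p - 1) * M₁ i ≤ (p - 1) * 1 := Nat.mul_le_mul_left _ this
        _ < p := by omega

/-! ## §3 ★★ The pole of the fibre line: the `U`-chart at `U = 0` -/

set_option maxHeartbeats 800000 in
-- one long polynomial bookkeeping proof
/-- ★★ **THE `U`-CHART `V(Φ_U)`, `Φ_U = B⁺·U − (y^{M₁})⁺`, IS FULL AT EVERY CLOSED POINT `(0; c)` OF THE POLE `U = 0` WITH `M₁ i ≤ 1` WHENEVER `c_i = 0`** (✓p694236 codes 2/4 at the point
`W = ∞` of the fibre line; every prime `p`; `B` arbitrary). Witness = the `U⁰`-term `(−A′)^{p−1}` of `θ(Φ_U)^{p−1}`. (Points with `U = u₀ ≠ 0` are `W`-chart points, `W = 1/u₀`.)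
[OURS · TASK 4b soundness; cite: Fedder1983, Thm. 1.12] -/
theorem fullCl_pencilChartU_pole_of_M₁_le_one (p : ℕ) [Fact p.Prime] [CharP k p] (M₁ : Fin n →₀ ℕ) (B : MvPolynomial (Fin n) k)
    (Φ : MvPolynomial (Fin (n + 1)) k) (hΦ : Φ = rename Fin.succ B * X 0 - rename Fin.succ (monomial M₁ (1 : k))) (hΦp : Prime Φ)
    (c : Fin n → k) (y : Spec (.of (MvPolynomial (Fin (n + 1)) k ⧸ Ideal.span {Φ}))) (hy : y.asIdeal.IsMaximal)
    (ha : y.asIdeal.comap (Ideal.Quotient.mk (Ideal.span {Φ})) =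
      Ideal.span (Set.range (Fin.cons (X 0 : MvPolynomial (Fin (n + 1)) k) fun i : Fin n => X i.succ - C (c i))))
    (htag : ∀ i, c i = 0 → M₁ i ≤ 1) :
    FullCl p ((Spec (.of (MvPolynomial (Fin (n + 1)) k ⧸ Ideal.span {Φ}))).presheaf.stalk y) := by
  classical
  have hp1 : 1 ≤ p := (Fact.out : p.Prime).one_lt.le
  -- the substitution (no shift of `U`)
  set v₀ : Fin n → MvPolynomial (Fin n) k := fun i => if c i = 0 then X i else C (c i) with hv₀
  set θ₀ : MvPolynomial (Fin n) k →ₐ[k] MvPolynomial (Fin n) k := aeval v₀ with hθ₀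
  set θ : MvPolynomial (Fin (n + 1)) k →ₐ[k] MvPolynomial (Fin (n + 1)) k :=
    aeval (Fin.cons (X 0) fun i : Fin n => rename Fin.succ (v₀ i)) with hθ
  have hθX0 : θ (X 0) = X 0 := by rw [hθ, aeval_X, Fin.cons_zero]
  have hθsucc : ∀ q : MvPolynomial (Fin n) k, θ (rename Fin.succ q) = rename Fin.succ (θ₀ q) := by
    intro q
    rw [hθ, aeval_rename, hθ₀, ← AlgHom.comp_apply]
    congr 1
    refine MvPolynomial.algHom_ext fun i => ?_
    rw [AlgHom.comp_apply, aeval_X, aeval_X, Function.comp_apply, Fin.cons_succ]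
  set α : k := ∏ i ∈ M₁.support with c i ≠ 0, c i ^ M₁ i with hα
  have hα0 : α ≠ 0 := theta0_scalar_ne_zero k c M₁
  set A' : MvPolynomial (Fin n) k := C α * monomial (M₁.filter fun i => c i = 0) 1 with hA'
  have hA'eq : θ₀ (monomial M₁ 1) = A' := by rw [hθ₀, hv₀, theta0_monomial]
  have hθΦ : θ Φ = rename Fin.succ (θ₀ B) * X 0 + rename Fin.succ (-A') := by
    have h1 : θ (rename Fin.succ (monomial M₁ (1 : k))) = rename Fin.succ A' := by rw [hθsucc, hA'eq]
    rw [hΦ, map_sub, map_mul, hθsucc, h1, hθX0, map_neg]; ring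
  -- in `k[y][U]`: the constant coefficient of `θ(Φ)^{p−1}` is `(−A′)^{p−1}`
  have hfs : finSuccEquiv k n (θ Φ) = Polynomial.C (θ₀ B) * Polynomial.X + Polynomial.C (-A') := by
    rw [hθΦ, map_add, map_mul, PencilIntegral.finSuccEquiv_rename_succ, PencilIntegral.finSuccEquiv_rename_succ, finSuccEquiv_X_zero]
  have hconst : ((finSuccEquiv k n (θ Φ)) ^ (p - 1)).coeff 0 = (-A') ^ (p - 1) := by
    rw [hfs, Polynomial.coeff_zero_eq_eval_zero, Polynomial.eval_pow, Polynomial.eval_add, Polynomial.eval_mul, Polynomial.eval_C, Polynomial.eval_X,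
      mul_zero, zero_add, Polynomial.eval_C]
  -- the witness monomial
  set d₀ : Fin n →₀ ℕ := (p - 1) • M₁.filter fun i => c i = 0 with hd₀
  have hcoeff : coeff (Finsupp.cons 0 d₀) (θ Φ ^ (p - 1)) = (-1) ^ (p - 1) * α ^ (p - 1) := by
    rw [← finSuccEquiv_coeff_coeff, map_pow, hconst, hA', neg_pow, mul_pow, ← map_pow, monomial_pow, one_pow,
      show ((-1 : MvPolynomial (Fin n) k) ^ (p - 1)) = C ((-1 : k) ^ (p - 1)) by rw [map_pow, map_neg, map_one], ← mul_assoc, ← map_mul, coeff_C_mul, ← hd₀,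
      coeff_monomial, if_pos rfl, mul_one]
  have hd : Finsupp.cons 0 d₀ ∈ ((θ : MvPolynomial (Fin (n + 1)) k →+* MvPolynomial (Fin (n + 1)) k) Φ ^ (p - 1)).support := by
    rw [mem_support_iff, RingHom.coe_coe, hcoeff]
    exact mul_ne_zero (pow_ne_zero _ (neg_ne_zero.2 one_ne_zero)) (pow_ne_zero _ hα0)
  refine PencilExitSoundnessKit.hypersurface_fullCl_stalk_of_reduction k p Φ hΦp _ y hy ha (θ : MvPolynomial (Fin (n + 1)) k →+* MvPolynomial (Fin (n + 1)) k)
    ({0} ∪ Set.range fun i : {i : Fin n // c i = 0} => (i.1.succ : Fin (n + 1))) (fun j => ?_) _ hd (fun j hj => ?_)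
  · refine Fin.cases ?_ (fun i => ?_) j
    · right
      exact ⟨0, Set.mem_union_left _ rfl, by rw [Fin.cons_zero, RingHom.coe_coe, hθX0]⟩
    · have hθi : θ (X i.succ) = rename Fin.succ (v₀ i) := by rw [hθ, aeval_X, Fin.cons_succ]
      by_cases hci : c i = 0
      · right
        refine ⟨i.succ, Set.mem_union_right _ ⟨⟨i, hci⟩, rfl⟩, ?_⟩
        rw [Fin.cons_succ, RingHom.coe_coe, map_sub, hθi, hv₀]; dsimp only; rw [if_pos hci, rename_X, hθ, aeval_C, algebraMap_eq, hci, C_0, sub_zero]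
      · left
        rw [Fin.cons_succ, RingHom.coe_coe, map_sub, hθi, hv₀]; dsimp only; rw [if_neg hci, rename_C, hθ, aeval_C, algebraMap_eq, sub_self]
  · rcases hj with hj | ⟨⟨i, hci⟩, rfl⟩
    · rw [Set.mem_singleton_iff] at hj; subst hj
      rw [Finsupp.cons_zero]; omega
    · rw [Finsupp.cons_succ, hd₀, Finsupp.smul_apply, Finsupp.filter_apply_pos (fun i => c i = 0) M₁ hci, smul_eq_mul]
      have := htag i hci
      calc (p - 1) * M₁ i ≤ (p - 1) * 1 := Nat.mul_le_mul_left _ this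
        _ < p := by omega

end Summit.ResolutionOfSingularities.ResolutionOfSingularities.Theorems.FInjectiveMacaulayfication.PencilExitTagW

end
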